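import Literature.NumberTheory.IwasawaTheory.ClassicalMuVanishesQuadraticAscentNarrowRat
import Literature.NumberTheory.EllipticCurves.FineSelmerLimThm35AtTwoUpstairsProofs
import HarnessLib

/-!
# Kida-lite for `K(√−1)`: narrow `μ₂(K) = 0` ⟹ `μ₂ = 0` for every cyclotomic `ℤ₂`-extension of `K ⊔ ℚ⟮i⟯` (`K ⊆ ℚ̄` of odd degree,
# `i² = −1`) — the number-field heart of the sextic-carrier road, outside any summit cone (proved; no definition, no named fact)

`Proofs`-style file (theorems only) in topic `NumberTheory/IwasawaTheory` (namespace `Literature.NumberTheory.IwasawaTheory`), written by the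
prover seat `cruxlead-stmt-BirchSwinnertonDyer-19573-w2` GEN 8 (cell `bsd-2adic`; `--supports` stmt-BirchSwinnertonDyer-19573; closes nothing).
It specialises the intrinsic Kida-lite ascent `classicalMu_of_sq_eq_of_odd_finrank_of_narrowDefect_le` (`ClassicalMuVanishesQuadraticAscentNarrowRat`)
to the generator `x = i`, `m = −1`: for a subfield `K ⊆ ℚ̄` of ODD degree and `i ∈ ℚ̄` with `i² = −1`, the field `K' = K ⊔ ℚ⟮i⟯ = K(i)` is
totally complex (tree `FineSelmerUpstairs.isComplex_of_mem_sq_eq_neg_one`), `K' = K[i]`, and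

  **(a) `μ₂ = 0` for every cyclotomic `ℤ₂`-extension of `K`  ∧  (b) `ord₂ h⁺(K_n) ≤ ord₂ h(K_n) + D` along their layers
   ⟹ `μ₂ = 0` for every cyclotomic `ℤ₂`-extension of `K ⊔ ℚ⟮i⟯`**  (`classicalMu_sup_adjoin_of_sq_eq_neg_one_of_narrowDefect_le`).

Hypothesis (b) is stated for ANY `NumberField` instance on the layer (`∀ [NumberField ↥(κP.layer n)]`), so that consumers can rewrite it along
equalities of subfields of `ℚ̄` (e.g. `ℚ̄^{Stab P} = ℚ(β)` for a `2`-torsion point `P = (β, 0)`).  The elliptic-curve consumers (sextic carrier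
`ℚ(P, √−1)` of w2 GEN 6's door; the Q⁺ road of crux 19573; the cubic-model door for C1″) are one-liners over this theorem
(`Summits/…/Theorems/ByReductionTypeAtTwoOrdKatoHalfAtTwoIsoConjATwoOfNarrowMu.lean`).

References: [Kida1982JFields] (shape of the transfer; not held); [Iwasawa1973MuInvariants] Thm. 2/3, §4 (`k′ = k(√−1)`); [Washington1997] §13.3
Prop. 13.23; [Lim2017FineSelmer] §3 (the carrier `F ∋ μ₄` has no real place).
-/

set_option autoImplicit false

noncomputable section

open scoped NumberField IntermediateField Polynomial
open NumberField Field Polynomial IntermediateField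

namespace Literature.NumberTheory.IwasawaTheory

open Literature.NumberTheory.EllipticCurves Literature.NumberTheory.EllipticCurves.ZpExtension
  Literature.NumberTheory.GaloisRepresentations Literature.NumberTheory.NumberFields

/-- **Narrow `μ₂(K) = 0` ⟹ `μ₂(K(√−1)) = 0`, for a subfield `K ⊆ ℚ̄` of ODD degree** (`i ∈ ℚ̄`, `i² = −1`): if every cyclotomic `ℤ₂`-extension `κP`
of `K` has (a) `ClassicalMuVanishes κP` and (b) `ord₂ h⁺(K_n) ≤ ord₂ h(K_n) + D` along its layers `K_n = (κP).layer n` (for any `NumberField` instance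
on the layer), then every cyclotomic `ℤ₂`-extension of `K ⊔ ℚ⟮i⟯` has `μ = 0`.  `K ⊔ ℚ⟮i⟯` is totally complex, equals `K[i]`, and `i ∈ 𝓞` with
`i² = −1 ∈ 𝓞_K ∖ 0`; then `classicalMu_of_sq_eq_of_odd_finrank_of_narrowDefect_le`. [cite: Kida1982JFields, main theorem (μ-part; shape only)]
[cite: Iwasawa1973MuInvariants, Thm. 2 and Thm. 3, §4] [cite: Washington1997, §13.3 Prop. 13.23] -/
theorem classicalMu_sup_adjoin_of_sq_eq_neg_one_of_narrowDefect_le (K : IntermediateField ℚ (AlgebraicClosure ℚ)) [FiniteDimensional ℚ ↥K]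
    (hodd : Odd (Module.finrank ℚ ↥K)) {i : AlgebraicClosure ℚ} (hi : i ^ 2 = -1)
    (hμ : ∀ κP : ZpExtension ↥K 2, κP.IsCyclotomic → ClassicalMuVanishes κP) (D : ℕ)
    (hδ : ∀ κP : ZpExtension ↥K 2, κP.IsCyclotomic → ∀ n : ℕ, ∀ [NumberField ↥(κP.layer n)],
      padicValNat 2 (narrowClassNumber ↥(κP.layer n)) ≤ padicValNat 2 (classNumber ↥(κP.layer n)) + D) :
    ∀ κF : ZpExtension ↥(K ⊔ IntermediateField.adjoin ℚ ({i} : Set (AlgebraicClosure ℚ))) 2,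
      κF.IsCyclotomic → ClassicalMuVanishes κF := by
  haveI : Fact (Nat.Prime 2) := ⟨Nat.prime_two⟩
  set Qi : IntermediateField ℚ (AlgebraicClosure ℚ) := IntermediateField.adjoin ℚ ({i} : Set (AlgebraicClosure ℚ)) with hQi
  -- the two number fields `K ⊆ K' = K ⊔ ℚ⟮i⟯`
  have hint : IsIntegral ℚ i := by
    refine ⟨X ^ 2 + 1, monic_X_pow_add_C _ two_ne_zero, ?_⟩
    simp [hi]
  haveI : FiniteDimensional ℚ ↥Qi := IntermediateField.adjoin.finiteDimensional hint
  haveI : NumberField ↥K := NumberField.of_module_finite ℚ _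
  haveI : FiniteDimensional ℚ ↥(K ⊔ Qi) := IntermediateField.finiteDimensional_sup K Qi
  haveI : NumberField ↥(K ⊔ Qi) := NumberField.of_module_finite ℚ _
  have hiK' : i ∈ K ⊔ Qi := (le_sup_right : Qi ≤ K ⊔ Qi) (IntermediateField.mem_adjoin_simple_self ℚ i)
  haveI : IsTotallyComplex ↥(K ⊔ Qi) := ⟨FineSelmerUpstairs.isComplex_of_mem_sq_eq_neg_one i hi _ hiK'⟩
  have hle : K ≤ K ⊔ Qi := le_sup_left
  letI : Algebra ↥K ↥(K ⊔ Qi) := (IntermediateField.inclusion hle).toRingHom.toAlgebra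
  haveI : IsScalarTower ℚ ↥K ↥(K ⊔ Qi) := IsScalarTower.of_algebraMap_eq fun _ ↦ rfl
  -- the generator `x = i ∈ 𝓞_{K'}`, `x² = −1`
  have hiint : IsIntegral ℤ i := by
    refine ⟨X ^ 2 + 1, monic_X_pow_add_C _ two_ne_zero, ?_⟩
    simp [hi]
  set x : 𝓞 ↥(K ⊔ Qi) := ⟨⟨i, hiK'⟩,
    (isIntegral_algHom_iff (IsScalarTower.toAlgHom ℤ ↥(K ⊔ Qi) (AlgebraicClosure ℚ)) Subtype.val_injective).mp hiint⟩ with hxdef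
  have hm : (-1 : 𝓞 ↥K) ≠ 0 := neg_ne_zero.mpr one_ne_zero
  have hx : x ^ 2 = algebraMap (𝓞 ↥K) (𝓞 ↥(K ⊔ Qi)) (-1) := by
    apply RingOfIntegers.ext
    apply Subtype.ext
    change i ^ 2 = (((algebraMap (𝓞 ↥K) (𝓞 ↥(K ⊔ Qi)) (-1) : 𝓞 ↥(K ⊔ Qi)) : ↥(K ⊔ Qi)) : AlgebraicClosure ℚ)
    rw [hi, map_neg, map_one]
    rfl
  -- `K' = K(i)`
  have hgen : Algebra.adjoin ↥K {((x : 𝓞 ↥(K ⊔ Qi)) : ↥(K ⊔ Qi))} = ⊤ := by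
    set T : Subalgebra ↥K ↥(K ⊔ Qi) := Algebra.adjoin ↥K {((x : 𝓞 ↥(K ⊔ Qi)) : ↥(K ⊔ Qi))} with hT
    let S : Subalgebra ℚ (AlgebraicClosure ℚ) :=
      { carrier := {w | ∃ hw : w ∈ K ⊔ Qi, (⟨w, hw⟩ : ↥(K ⊔ Qi)) ∈ T}
        mul_mem' := by
          rintro a b ⟨ha, ha'⟩ ⟨hb, hb'⟩
          exact ⟨mul_mem ha hb, by
            have e : (⟨a * b, mul_mem ha hb⟩ : ↥(K ⊔ Qi)) = ⟨a, ha⟩ * ⟨b, hb⟩ := rfl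
            rw [e]; exact T.mul_mem ha' hb'⟩
        one_mem' := ⟨one_mem _, by
          have e : (⟨1, one_mem _⟩ : ↥(K ⊔ Qi)) = 1 := rfl
          rw [e]; exact T.one_mem⟩
        add_mem' := by
          rintro a b ⟨ha, ha'⟩ ⟨hb, hb'⟩
          exact ⟨add_mem ha hb, by
            have e : (⟨a + b, add_mem ha hb⟩ : ↥(K ⊔ Qi)) = ⟨a, ha⟩ + ⟨b, hb⟩ := rfl
            rw [e]; exact T.add_mem ha' hb'⟩
        zero_mem' := ⟨zero_mem _, by
          have e : (⟨0, zero_mem _⟩ : ↥(K ⊔ Qi)) = 0 := rfl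
          rw [e]; exact T.zero_mem⟩
        algebraMap_mem' := fun t ↦ ⟨IntermediateField.algebraMap_mem (K ⊔ Qi) t, T.algebraMap_mem (algebraMap ℚ ↥K t)⟩ }
    have hKS : ∀ w (hw : w ∈ K), w ∈ S := fun w hw ↦ ⟨hle hw, by
      have e : (⟨w, hle hw⟩ : ↥(K ⊔ Qi)) = algebraMap ↥K ↥(K ⊔ Qi) ⟨w, hw⟩ := rfl
      rw [e]; exact T.algebraMap_mem _⟩
    have hiS : i ∈ S := ⟨hiK', Algebra.subset_adjoin (Set.mem_singleton _)⟩
    have hQiS : Qi.toSubalgebra ≤ S := by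
      rw [hQi, IntermediateField.adjoin_simple_toSubalgebra_of_isAlgebraic hint.isAlgebraic]
      exact Algebra.adjoin_le (Set.singleton_subset_iff.mpr hiS)
    have hK'S : (K ⊔ Qi).toSubalgebra ≤ S := by
      haveI : Algebra.IsAlgebraic ℚ ↥Qi := Algebra.IsAlgebraic.of_finite ℚ ↥Qi
      rw [IntermediateField.sup_toSubalgebra_of_isAlgebraic_right]
      exact sup_le (fun w hw ↦ hKS w hw) hQiS
    rw [eq_top_iff]
    rintro ⟨w, hw⟩ -
    obtain ⟨hw', h⟩ := hK'S hw
    exact h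
  refine classicalMu_of_sq_eq_of_odd_finrank_of_narrowDefect_le ↥K ↥(K ⊔ Qi) hodd hm hx hgen hμ D (fun κP hκP n ↦ ?_)
  haveI : FiniteDimensional ↥K ↥(κP.layer n) := κP.finiteDimensional_layer_holds n
  haveI : NumberField ↥(κP.layer n) := NumberField.of_module_finite ↥K _
  exact hδ κP hκP n

end Literature.NumberTheory.IwasawaTheory

end
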